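import Summits.QuantumFields.BalabanUV.Beta.EriceRemainderEnclosureHistoryAutonomyComparisonDualComparison

/-!
# EriceRemainderEnclosureHistoryAutonomyComparisonDualComparisonEnd — (E135c) ENDS of the lattice theorem (D‴) ((E135b) `le_of_isotone_excess_affine`: comparison at any
# size for every isotone excess over the affine base), in the vocabulary of the earlier files of the comparison column: (1) **`le_of_const_excess_markov`** — the CONSTANT
# excess `B′ = B + η` (`η ≥ 0`) over `B u = β₀ + Σ_{k<K} L_k·u_k` WITH the Markov weight `L_0` free: `h′ ≤ h` at every scale ((E118e) `le_of_const_excess` had `L_0 = 0`);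
# (2) **`family_le_of_isotone_excess_affine`** — the family form: box-solution families `S`, `S′` of `B`, `B′` satisfy `S′ x ≤ S x` at every scale from every pin;
# (3) **`succ_le_base_step_of_isotone_excess_affine`** — the dual effective-β order along every perturbed orbit: from every point `h′_m` of a `B′`-solution the base's
# first step stays above the perturbed one, `h′_{m+1} ≤ k_1` for ANY box solution `k` of `B` from `h′_m` (the dual step `X′_m ≥ 0` of (E132), family-free).

Cell `pub-balaban`, β-function sub-cell, BINDER row D4 «RemainderConst leaves for Bałaban's split» (`HOME/BINDER-OWNERS.md`; owner lineage `b2b-balaban-beta-an4`;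
this file by co-owner #2 lineage `b2b-balaban-beta-d4-p2`, generation 104), β-FLOW TEAM duty (1), FREEZE (0) honoured (def-free; imports (E135b)
`…ComparisonDualComparison` and uses its `le_of_isotone_excess_affine` BY NAME; nothing restated).

HONEST FRAMING (page 1, verbatim and binding).  *"Discharging BetaPertH makes Bałaban's UV stability UNCONDITIONAL — a real constructive-QFT result; it is
NOT the continuum limit and NOT the Clay problem."*  THIS FILE DISCHARGES NOTHING OF THE KIND.  Elementary real analysis about ABSTRACT functionals on a box
]0,γ]^ℕ — hypotheses of a census, not facts; the form, signs, ages and moments of Bałaban's (1.22) limit functional are NOT PRINTED ([I] p. 298; GAPS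
G-t4-U2-1∕-2) and NOT asserted.  Row D4 class UNCHANGED (critical-path width 0; instance 0∕1; D4 DISCHARGE NO DATE).  NOT B12 Thm 2, NOT BetaPertH, NOT continuum,
NOT Clay.

WHAT IS PROVED ([folklore]; 0 `def`, 0 sorry).  **`le_of_const_excess_markov`**, **`family_le_of_isotone_excess_affine`**, **`succ_le_base_step_of_isotone_excess_affine`**.
-/

noncomputable section
open Finset Set

namespace Summit.QuantumFields.BalabanUV.Beta.EriceRemainderEnclosureHistoryAutonomyComparisonDualComparisonEnd

open Literature.MathematicalPhysics.QuantumFieldTheory.Balaban1983to89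
open Literature.MathematicalPhysics.QuantumFieldTheory.Balaban1983to89.T4BetaStationary
open Literature.MathematicalPhysics.QuantumFieldTheory.Balaban1983to89.T4BetaFlowWellPosed
open Summit.QuantumFields.BalabanUV.Beta.EriceRemainderEnclosureHistoryAutonomyComparisonDualComparison (le_of_isotone_excess_affine)

variable {B B' : (ℕ → ℝ) → ℝ} {γ β₀ : ℝ} {L : ℕ → ℝ} {K : ℕ}

/-- **COMPARISON AT ANY SIZE FOR THE CONSTANT EXCESS, MARKOV WEIGHT INCLUDED.**  `B u = β₀ + Σ_{k<K} L_k·u_k` on the box (`β₀ > 0`, `L ≥ 0`, the weight `L_0` of the newest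
coupling FREE, all sizes arbitrary), `B′ = B + η` on the box with `η ≥ 0`; `h`, `h′` ANY box solutions of `B`, `B′` from one pin.  Then `h′ ≤ h` at every scale —
(E118e) `le_of_const_excess` without `L_0 = 0`, as the constant-excess case of (E135b). [folklore] -/
theorem le_of_const_excess_markov {η p : ℝ} {h h' : ℕ → ℝ} (hBaff : ∀ u, SeqBox γ u → B u = β₀ + ∑ k ∈ range K, L k * u k) (hL : ∀ k, 0 ≤ L k)
    (hβ : 0 < β₀) (hB'eq : ∀ u, SeqBox γ u → B' u = B u + η) (hη : 0 ≤ η)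
    (hp : 0 < p) (hpγ : p ≤ γ) (hh : SeqBox γ h) (hf : MemFlow B p h) (hh' : SeqBox γ h') (hf' : MemFlow B' p h') (j : ℕ) :
    h' j ≤ h j := by
  -- B′ inherits the zeroth moment Σ L_k of B
  have hB' : ∀ u u' : ℕ → ℝ, SeqBox γ u → SeqBox γ u' → ∀ D : ℝ, (∀ j, |u j - u' j| ≤ D) → |B' u - B' u'| ≤ (∑ k ∈ range K, L k) * D := by
    intro u u' hu hu' D hD
    rw [hB'eq u hu, hB'eq u' hu', hBaff u hu, hBaff u' hu']
    have e : β₀ + ∑ k ∈ range K, L k * u k + η - (β₀ + ∑ k ∈ range K, L k * u' k + η) = ∑ k ∈ range K, L k * (u k - u' k) := by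
      have : ∑ k ∈ range K, L k * (u k - u' k) = ∑ k ∈ range K, L k * u k - ∑ k ∈ range K, L k * u' k := by
        rw [← sum_sub_distrib]; exact sum_congr rfl fun k _ => by ring
      rw [this]; ring
    rw [e, sum_mul]
    refine (abs_sum_le_sum_abs _ _).trans (sum_le_sum fun k _ => ?_)
    rw [abs_mul, abs_of_nonneg (hL k)]
    exact mul_le_mul_of_nonneg_left (hD k) (hL k)
  have hM' : 0 ≤ ∑ k ∈ range K, L k := sum_nonneg fun k _ => hL k
  have hexc : ∀ u, SeqBox γ u → B u ≤ B' u := fun u hu => by rw [hB'eq u hu]; linarith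
  have hDmono : ∀ u v : ℕ → ℝ, SeqBox γ u → SeqBox γ v → (∀ j, u j ≤ v j) → B' u - B u ≤ B' v - B v := fun u v hu hv _ => by
    rw [hB'eq u hu, hB'eq v hv]; linarith
  exact le_of_isotone_excess_affine hBaff hL hβ hB' hM' hexc hDmono hp hpγ hh hf hh' hf' j

/-- **THE FAMILY FORM.**  Box-solution families `S` of the affine `B` and `S′` of `B′` (zeroth moment, `B′ ≥ B`, isotone excess): `S′ x ≤ S x` at every scale from every
pin `x ∈ ]0,γ]`. [folklore] -/
theorem family_le_of_isotone_excess_affine {M' : ℝ} {S S' : ℝ → ℕ → ℝ} (hBaff : ∀ u, SeqBox γ u → B u = β₀ + ∑ k ∈ range K, L k * u k)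
    (hL : ∀ k, 0 ≤ L k) (hβ : 0 < β₀)
    (hB' : ∀ u u' : ℕ → ℝ, SeqBox γ u → SeqBox γ u' → ∀ D : ℝ, (∀ j, |u j - u' j| ≤ D) → |B' u - B' u'| ≤ M' * D) (hM' : 0 ≤ M')
    (hexc : ∀ u, SeqBox γ u → B u ≤ B' u)
    (hDmono : ∀ u v : ℕ → ℝ, SeqBox γ u → SeqBox γ v → (∀ j, u j ≤ v j) → B' u - B u ≤ B' v - B v)
    (hS : ∀ p, 0 < p → p ≤ γ → SeqBox γ (S p) ∧ MemFlow B p (S p)) (hS' : ∀ p, 0 < p → p ≤ γ → SeqBox γ (S' p) ∧ MemFlow B' p (S' p))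
    {x : ℝ} (hx : 0 < x) (hxγ : x ≤ γ) (j : ℕ) : S' x j ≤ S x j :=
  le_of_isotone_excess_affine hBaff hL hβ hB' hM' hexc hDmono hx hxγ (hS x hx hxγ).1 (hS x hx hxγ).2 (hS' x hx hxγ).1 (hS' x hx hxγ).2 j

/-- **THE DUAL EFFECTIVE-β ORDER ALONG EVERY PERTURBED ORBIT (family-free).**  `h′` a box solution of `B′` from any pin; from its point `h′_m` let `k` be ANY box solution
of the affine `B`.  Then `h′_{m+1} ≤ k_1`: the perturbed orbit's next point lies below the base's — equivalently the dual step of (E132) is non-negative,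
`B(k_1, k_2, …) ≤ B′(h′_{m+1}, h′_{m+2}, …)`.  (The tail of `h′` from `h′_m` is a `B′`-solution from that pin; apply (E135b).) [folklore] -/
theorem succ_le_base_step_of_isotone_excess_affine {M' p : ℝ} {h' k : ℕ → ℝ} (hBaff : ∀ u, SeqBox γ u → B u = β₀ + ∑ k ∈ range K, L k * u k)
    (hL : ∀ k, 0 ≤ L k) (hβ : 0 < β₀)
    (hB' : ∀ u u' : ℕ → ℝ, SeqBox γ u → SeqBox γ u' → ∀ D : ℝ, (∀ j, |u j - u' j| ≤ D) → |B' u - B' u'| ≤ M' * D) (hM' : 0 ≤ M')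
    (hexc : ∀ u, SeqBox γ u → B u ≤ B' u)
    (hDmono : ∀ u v : ℕ → ℝ, SeqBox γ u → SeqBox γ v → (∀ j, u j ≤ v j) → B' u - B u ≤ B' v - B v)
    (hh' : SeqBox γ h') (hf' : MemFlow B' p h') (m : ℕ) (hk : SeqBox γ k) (hfk : MemFlow B (h' m) k) :
    h' (m + 1) ≤ k 1 ∧ B (fun i => k (1 + i)) ≤ B' (fun i => h' (m + 1 + i)) := by
  have htailbox : SeqBox γ (fun i => h' (m + i)) := fun i => hh' (m + i)
  have htailflow : MemFlow B' (h' m) (fun i => h' (m + i)) := by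
    refine ⟨by simp, fun q => ?_⟩
    have := hf'.2 (m + q)
    simpa [Nat.add_assoc] using this
  have hle : h' (m + 1) ≤ k 1 :=
    le_of_isotone_excess_affine hBaff hL hβ hB' hM' hexc hDmono (hh' m).1 (hh' m).2 hk hfk htailbox htailflow 1
  refine ⟨hle, ?_⟩
  -- level form
  have e1 : 1 / h' (m + 1) ^ 2 = 1 / h' m ^ 2 + B' (fun i => h' (m + 1 + i)) := hf'.2 m
  have e2 : 1 / k (0 + 1) ^ 2 = 1 / k 0 ^ 2 + B (fun i => k (0 + 1 + i)) := hfk.2 0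
  rw [hfk.1] at e2
  have e3 : (fun i => k (0 + 1 + i)) = (fun i => k (1 + i)) := by funext i; simp
  rw [e3] at e2; simp only [Nat.zero_add] at e2
  have hk1 : 0 < k 1 := (hk 1).1
  have hp1 : 0 < h' (m + 1) := (hh' (m + 1)).1
  have hlev : 1 / k 1 ^ 2 ≤ 1 / h' (m + 1) ^ 2 := one_div_le_one_div_of_le (pow_pos hp1 2) (pow_le_pow_left₀ hp1.le hle 2)
  linarith

end Summit.QuantumFields.BalabanUV.Beta.EriceRemainderEnclosureHistoryAutonomyComparisonDualComparisonEnd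

end
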